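import Literature.Geometry.Riemannian.MetricFlowPhi
import Mathlib.Analysis.Calculus.InverseFunctionTheorem.Deriv
import Mathlib.Analysis.Calculus.InverseFunctionTheorem.ContDiff
import HarnessLib

/-!
# The inverse `Φ⁻¹ : (0, 1) → ℝ` of Bamler's `Φ` (Bamler 2020a, §4.1)

R. Bamler, *Entropy and heat kernel bounds on a Ricci flow background*, arXiv:2008.07093, §4.1:
"For any `t > 0` denote by `Φ_t⁻¹ : (0,1) → ℝ` the inverse function of `Φ_t : ℝ → (0,1)`", where
`Φ_t(x) = Φ(t^{-1/2} x)` and `Φ` is the antiderivative of `(4π)^{-1/2} e^{-x²/4}` (`MetricFlow.Phi`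
of `MetricFlow.lean`; its calculus is `MetricFlowPhi.lean`). The gradient estimate (Thm. 4.1) is
stated through `h = Φ_t⁻¹ ∘ u`. This file defines the inverse at `t = 1` and proves what the
composition `Φ⁻¹ ∘ u` of a smooth `(0,1)`-valued function needs:

* `MetricFlow.PhiInv` — the inverse of `Φ` on `(0, 1)` (`Function.invFun Φ`; junk off `(0, 1)`);
* `PhiInv_Phi`, `Phi_PhiInv` — two-sided inverse between `ℝ` and `(0, 1)`;
* `hasStrictDerivAt_PhiInv`, `hasDerivAt_PhiInv` — `(Φ⁻¹)'(Φ x) = 1/Φ'(x)`;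
* `contDiffAt_PhiInv`, `contDiffOn_PhiInv` — `Φ⁻¹` is `C^∞` on `(0, 1)` (inverse function theorem).

Everything is proved; the only definition is `PhiInv`; no named facts.
-- TODO(general form): the rescaled `Φ_t`, `Φ_t⁻¹(u) = √t · Φ⁻¹(u)` (Bamler 2020a §4.1).

## References

* R. H. Bamler, *Entropy and heat kernel bounds on a Ricci flow background*, arXiv:2008.07093
  (2020), §4.1. [Bamler2020Entropy]
-/

noncomputable section

open Set Filter
open scoped Topology ContDiff

namespace Literature.Geometry.Riemannian

namespace MetricFlow

/-- **`Φ⁻¹`**, the inverse of Bamler's `Φ : ℝ → (0, 1)` (Bamler 2020a, §4.1, at `t = 1`): a left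
inverse of the injective `Φ` (`Function.invFun`), hence the inverse bijection `(0, 1) → ℝ`; its
values off `(0, 1)` are junk. [cite: Bamler2020Entropy, §4.1] -/
def PhiInv : ℝ → ℝ := Function.invFun Phi

/-- `Φ⁻¹ (Φ x) = x`. [cite: Bamler2020Entropy, §4.1] -/
@[simp] theorem PhiInv_Phi (x : ℝ) : PhiInv (Phi x) = x :=
  Function.leftInverse_invFun Phi_strictMono.injective x

/-- `Φ (Φ⁻¹ c) = c` for `c ∈ (0, 1)`. [cite: Bamler2020Entropy, §4.1] -/
theorem Phi_PhiInv {c : ℝ} (hc0 : 0 < c) (hc1 : c < 1) : Phi (PhiInv c) = c :=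
  Function.invFun_eq (exists_Phi_eq hc0 hc1)

/-- `Φ⁻¹` is strictly increasing on `(0, 1)`. [cite: Bamler2020Entropy, §4.1] -/
theorem PhiInv_strictMonoOn : StrictMonoOn PhiInv (Ioo 0 1) := by
  intro a ha b hb hab
  by_contra h
  have h' : PhiInv b ≤ PhiInv a := le_of_not_gt h
  have := Phi_strictMono.monotone h'
  rw [Phi_PhiInv ha.1 ha.2, Phi_PhiInv hb.1 hb.2] at this
  exact absurd hab (not_lt.2 this)

/-- **`(Φ⁻¹)'(Φ x) = (Φ'(x))⁻¹`** (strict derivative; `Φ⁻¹` is a left inverse of `Φ`, whose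
derivative does not vanish). [cite: Bamler2020Entropy, §4.1] -/
theorem hasStrictDerivAt_PhiInv (x : ℝ) :
    HasStrictDerivAt PhiInv ((Real.sqrt (4 * Real.pi))⁻¹ * Real.exp (-x ^ 2 / 4))⁻¹ (Phi x) := by
  have hstrict : HasStrictDerivAt Phi ((Real.sqrt (4 * Real.pi))⁻¹ * Real.exp (-x ^ 2 / 4)) x := by
    have h := contDiff_Phi.contDiffAt.hasStrictDerivAt (x := x) (by simp)
    rwa [deriv_Phi] at h
  have hne : (Real.sqrt (4 * Real.pi))⁻¹ * Real.exp (-x ^ 2 / 4) ≠ 0 := by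
    rw [← deriv_Phi]; exact (deriv_Phi_pos x).ne'
  exact hstrict.to_local_left_inverse hne (Eventually.of_forall PhiInv_Phi)

/-- `(Φ⁻¹)'(Φ x) = (Φ'(x))⁻¹`. [cite: Bamler2020Entropy, §4.1] -/
theorem hasDerivAt_PhiInv (x : ℝ) :
    HasDerivAt PhiInv ((Real.sqrt (4 * Real.pi))⁻¹ * Real.exp (-x ^ 2 / 4))⁻¹ (Phi x) :=
  (hasStrictDerivAt_PhiInv x).hasDerivAt

/-- **`Φ⁻¹` is `C^∞` at every point of `(0, 1)`** (written as `Φ x`): the inverse function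
theorem's local inverse is `C^∞` and agrees with `Φ⁻¹` near `Φ x`. [cite: Bamler2020Entropy, §4.1] -/
theorem contDiffAt_PhiInv (x : ℝ) : ContDiffAt ℝ ∞ PhiInv (Phi x) := by
  have hcd : ContDiffAt ℝ ∞ Phi x := contDiff_Phi.contDiffAt
  have hne : (Real.sqrt (4 * Real.pi))⁻¹ * Real.exp (-x ^ 2 / 4) ≠ 0 := by
    rw [← deriv_Phi]; exact (deriv_Phi_pos x).ne'
  have hF := (hasDerivAt_Phi x).hasFDerivAt_equiv hne
  have hn : (∞ : ℕ∞ω) ≠ 0 := by simp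
  have hloc := hcd.to_localInverse hF hn
  refine hloc.congr_of_eventuallyEq ?_
  filter_upwards [(hcd.hasStrictFDerivAt' hF hn).eventually_right_inverse] with y hy
  calc PhiInv y = PhiInv (Phi ((hcd.hasStrictFDerivAt' hF hn).localInverse Phi _ x y)) := by rw [hy]
    _ = _ := PhiInv_Phi _

/-- **`Φ⁻¹` is `C^∞` on `(0, 1)`.** [cite: Bamler2020Entropy, §4.1] -/
theorem contDiffOn_PhiInv : ContDiffOn ℝ ∞ PhiInv (Ioo 0 1) := by
  intro c hc
  obtain ⟨x, rfl⟩ := exists_Phi_eq hc.1 hc.2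
  exact (contDiffAt_PhiInv x).contDiffWithinAt

/-- `Φ⁻¹` is continuous on `(0, 1)`. [cite: Bamler2020Entropy, §4.1] -/
theorem continuousOn_PhiInv : ContinuousOn PhiInv (Ioo 0 1) := contDiffOn_PhiInv.continuousOn

end MetricFlow

end Literature.Geometry.Riemannian

end
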